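import Summits.QuantumFields.YangMills.Theorems.AlphaInputsT3ACv3RegionSection
import HarnessLib

/-!
# `AlphaInputsT3ACv3InnerLiftFromRegionalThm1` — STRATEGY B for 2′: **(FL) ⇐ THEOREM 1's EXISTENCE CLAUSE (8) ON THE REGION, ONE LEVEL DOWN, + THE SECTION (11)** — print's own route
# to the regular exact lift ([Balaban1985Variational] (11)–(14) pp.279–280) typed on `Ω_k(h)` with free boundary: `InnerFineLiftsT3 (B·L²)` follows from «for every level-`k` datum `V`
# windowed inside `Ω_{k+1}(h)` there is a finest field with exact `k`-fold averages `V` on `bondsIn k Ω_{k+1}(h)` and finest plaquettes under `Ω_{k+1}(h)` within `B·ε·L^{−2k}`» applied to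
# `V := faceSec W` — lane `pub-balaban3d` ∕ cell `ym3-torus`, seat `ym-ust-19936-w1` (g0)

WHY (this seat's PROGRESS 5, 2026-08-28; `…v3RegionSection`).  Print obtains the regular exact lift at height `k` (the non-emptiness of (8), our (FL)) from the MINIMISER one level down:
(11) the section `V₀` of the datum, (12) Theorem 1 at height `k − 1` applied to `V₀`, (13)–(14) the height-`k` reading with `C₁ = L³` (`L²` for the plaquette clause alone).  The
package's minimiser row r1 (`…v2.MinimiserRowsT3`, `T3PrintedMinimiserExistence.Thm1GlobalMinAt`) is the GLOBAL reading (trivial history, datum windowed on the whole torus) and does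
not serve a CHARGED `W` on `Ω_k(h)`.  THIS FILE records, kernel-checked and WITHOUT introducing a schema, exactly what the REGIONAL existence clause must say for print's route to
supply (FL): ★★ `AlphaInputsT3AC.innerFineLiftsT3_of_regionalLifts` — if for every `k + 1 ≤ K`, every admissible non-trivial level-`(k+1)` history `h` and every level-`k` field `V` whose
plaquettes in `plaqsIn k Ω_{k+1}(h)` are within `ε_W(k+1)` of `1` there is `U` on the finest lattice with `(blockAvg ℰp)^k U = V` on `bondsIn k Ω_{k+1}(h)` and finest plaquettes under
`Ω_{k+1}(h)` `< B·ε_W(k+1)·L^{−2k}` (the binder `hLift` — Thm 1 (8) p.279, existence + fine regularity only, read on the region with free seam; NOT in the tree, NOT asserted), then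
`InnerFineLiftsT3 F 𝔠 γ hγ hγ1 K (B·L²)`: at `k + 1` take `V := faceSec W` — windowed inside `Ω_{k+1}(h)` with the SAME `ε_W(k+1)` (§1 `faceSec_window_region`, the one-step regional
dichotomy), exact `(k+1)`-fold averages by `avgFun_faceSec` and the exact two-block locality of (0.4) on the dependency-closed read family of `Ω_{k+1}(h)` (`LocalSmallLoop.avgFun_local₂`,
`depClosed₂_regionBondsT3`), plaquettes `B·ε·L^{−2k} = (B·L²)·ε·L^{−2(k+1)}` ((13) with `C₁ = L²`); at `k = 0` take `U := W`.
HONEST FRAMING.  A located REDUCTION; the regional Theorem 1 row is a hypothesis binder here, never asserted, and (FL) is NOT proved; whether the lane adopts «(FL) ⇐ r1^reg + (11)» or the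
unprinted kinematic lift is the OWNER's call (PROGRESS 5 question).  Count-neutral helper toward R3 2′ (items 19936∕19935); registry untouched; nothing about d = 4, the continuum, or a
mass gap; YM₃ on T³ is rung R3, not Clay.

References: T. Bałaban, Commun. Math. Phys. 102 (1985) 277–309 [Balaban1985Variational] (Thm 1 (8) p.279, (11)–(14) pp.279–280); CMP 102 (1985) 255–275 [Balaban1985UV3] ((40)–(42)
p.266); CMP 109 (1987) 249–301 [Balaban1987RG1] ((0.4) p.253).
-/

set_option autoImplicit false

noncomputable section

namespace Summit.QuantumFields.YangMills.Theorems

open Set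
open scoped Matrix.Norms.L2Operator
open Literature.MathematicalPhysics.QuantumFieldTheory.Balaban1983to89
open Literature.MathematicalPhysics.QuantumFieldTheory.Balaban1983to89.T3ContinuumYM3Torus
open Literature.MathematicalPhysics.QuantumFieldTheory.Balaban1983to89.T3UnitLawDensityEML (ℰp)
open Literature.MathematicalPhysics.QuantumFieldTheory.Balaban1983to89.T3UnitScaleTilt (θBal)
open Literature.MathematicalPhysics.QuantumFieldTheory.Balaban1983to89.T3DescentFibreTower (expMeanLogSU_E_one)
open Literature.MathematicalPhysics.QuantumFieldTheory.Balaban1983to89.B10Eq38TorusDomains (plaqsIn mem_plaqsIn_iff toFine)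
open Literature.MathematicalPhysics.QuantumFieldTheory.Balaban1983to89.B10Eq42TorusConstraint (bondsIn lam42 lam42_self)
open Literature.MathematicalPhysics.QuantumFieldTheory.Balaban1983to89.BlockAveragingSection (faceSec avgFun_faceSec)
open Literature.MathematicalPhysics.QuantumFieldTheory.Balaban1983to89.BlockAveragingSectionPlaq (offset plaqHol_faceSec)
open Literature.MathematicalPhysics.QuantumFieldTheory.Balaban1985CMP102.Setting
open Summit.QuantumFields.Balaban3D.Carriers
open Summit.QuantumFields.Balaban3D.Proofs.Primitives (AlphaConsts)
open Summit.QuantumFields.YangMills.Theorems.LocalSmallLoop (avgFun_local₂)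

section T3

variable {F : T3Family} {𝔠 : AlphaConsts F.L (suGroupModel 2).N} {γ : ℝ} {hγ : 0 < γ} {hγ1 : γ ≤ (min 𝔠.gamma0 1) ^ 2} {K : ℕ}

/-! ## §1 (11) one step: the face section of a datum windowed inside `Ω_{k+1}(h)` is windowed inside `Ω_{k+1}(h)` with the same constant -/

/-- **THE FACE SECTION KEEPS THE REGIONAL WINDOW** (`k + 1 ≤ K`, `0 ≤ ε`): if the level-`(k+1)` plaquettes of `W` inside `Ω_{k+1}(h)` are within `ε` of `1`, so are the level-`k` plaquettes of
`faceSec W` inside `Ω_{k+1}(h)` — each is `1` or the coarse plaquette over it, whose corners are the blocks of its corners (`plaqHol_faceSec`, `mem_under_Omega_iff_blockOf`).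
[cite: Balaban1985Variational, (11) p.279] -/
theorem AlphaInputsT3AC.faceSec_window_region {k : ℕ} (hk : k + 1 ≤ K) (h : Hist (F.P K) (k + 1))
    (W : GaugeField (F.P K) (k + 1) (Matrix.specialUnitaryGroup (Fin 2) ℂ)) {ε : ℝ} (hε : 0 ≤ ε)
    (hW : ∀ Q : Plaq (F.P K) (k + 1), Q ∈ plaqsIn (k + 1) (Omega 𝔠.lane.carrier.M₁
        (rcolOf (T3Scales F γ hγ (hγ1.trans (sq_min_one_le _ 𝔠.gamma0_pos)) K) 𝔠.lane.carrier) (k + 1) h (k + 1)) →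
      GaugeGroup.dist1 (GaugeField.plaqHol W Q) ≤ ε)
    (q : Plaq (F.P K) k) (hq : q ∈ plaqsIn k (Omega 𝔠.lane.carrier.M₁
        (rcolOf (T3Scales F γ hγ (hγ1.trans (sq_min_one_le _ 𝔠.gamma0_pos)) K) 𝔠.lane.carrier) (k + 1) h (k + 1))) :
    GaugeGroup.dist1 (GaugeField.plaqHol (faceSec W) q) ≤ ε := by
  have hk' : k + 1 ≤ (F.P K).m + (F.P K).K := AlphaInputsT3AC.le_standing_of_le hk
  obtain ⟨h1, h2, h3, h4⟩ := AlphaInputsT3AC.mem_plaqsIn_iff_corners.1 hq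
  rw [plaqHol_faceSec hk' W q]
  by_cases hedge : offset q.src q.μ = (F.P K).L - 1 ∧ offset q.src q.ν = (F.P K).L - 1
  · rw [if_pos hedge]
    obtain ⟨e1, e2, e3⟩ := RegionSection.blockOf_corners_of_edge hk' q hedge.1 hedge.2
    have key := fun z => (AlphaInputsT3AC.mem_under_Omega_iff_blockOf (hγ := hγ) (hγ1 := hγ1) hk h (Nat.lt_succ_self k) z).1
    refine hW _ (AlphaInputsT3AC.mem_plaqsIn_iff_corners.2 ⟨key _ h1, ?_, ?_, ?_⟩)
    · show toFine (k + 1) ((blockOf q.src).shift q.μ) ∈ _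
      rw [← e1]; exact key _ h2
    · show toFine (k + 1) ((blockOf q.src).shift q.ν) ∈ _
      rw [← e2]; exact key _ h3
    · show toFine (k + 1) (((blockOf q.src).shift q.μ).shift q.ν) ∈ _
      rw [← e3]; exact key _ h4
  · rw [if_neg hedge, GaugeGroup.dist1_one]
    exact hε

/-! ## §2 (12)–(13): an exact regular `k`-fold lift of `faceSec W` on the region is an exact regular `(k+1)`-fold lift of `W` -/

/-- **EXACTNESS COMPOSES THROUGH THE SECTION ON THE REGION** (`k + 1 ≤ K`): if `(blockAvg ℰp)^k U = faceSec W` on `bondsIn k Ω_{k+1}(h)` then `(blockAvg ℰp)^{k+1} U = W` on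
`bondsIn (k+1) Ω_{k+1}(h)` — the (0.4) average at a bond of the region reads only level-`k` bonds with both ends in its two blocks, all in the region (`avgFun_local₂`,
`depClosed₂_regionBondsT3`), and `avgFun ℰp (faceSec W) = W`. [cite: Balaban1985Variational, (11)–(13) pp.279–280; Balaban1985UV3, (42) p.266] -/
theorem AlphaInputsT3AC.mem_top42Set_of_iter_eq_faceSec {k : ℕ} (hk : k + 1 ≤ K) (h : Hist (F.P K) (k + 1))
    (W : GaugeField (F.P K) (k + 1) (Matrix.specialUnitaryGroup (Fin 2) ℂ)) {U : GaugeField (F.P K) 0 (Matrix.specialUnitaryGroup (Fin 2) ℂ)}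
    (hU : ∀ b : PBond (F.P K) k, b ∈ bondsIn k (Omega 𝔠.lane.carrier.M₁
        (rcolOf (T3Scales F γ hγ (hγ1.trans (sq_min_one_le _ 𝔠.gamma0_pos)) K) 𝔠.lane.carrier) (k + 1) h (k + 1)) →
      Averaging.iter (fun i => BlockAveraging.blockAvg (P := F.P K) (j := i) ℰp) k U b = faceSec W b) :
    U ∈ AlphaInputsT3AC.top42Set F 𝔠 γ hγ hγ1 K (k + 1) h W := by
  have hk' : k + 1 ≤ (F.P K).m + (F.P K).K := AlphaInputsT3AC.le_standing_of_le hk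
  intro c hc
  show (BlockAveraging.blockAvg ℰp).avg (Averaging.iter (fun i => BlockAveraging.blockAvg (P := F.P K) (j := i) ℰp) k U) c = W c
  rw [BlockAveraging.blockAvg_avg]
  have hdep := AlphaInputsT3AC.depClosed₂_regionBondsT3 (𝔠 := 𝔠) (hγ := hγ) (hγ1 := hγ1) hk h (k + 1)
  have hc' : c ∈ AlphaInputsT3AC.regionBondsT3 F 𝔠 γ hγ hγ1 K (k + 1) h (k + 1) (k + 1) := by
    refine ⟨le_rfl, le_rfl, ?_⟩
    rw [lam42_self]; exact hc
  rw [avgFun_local₂ ℰp hk' _ (faceSec W) c fun b hb => ?_]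
  · exact congrFun (avgFun_faceSec hk' ℰp expMeanLogSU_E_one W) c
  · have hb' := hdep k c hc' b hb
    obtain ⟨-, -, hb''⟩ := hb'
    rw [lam42_self] at hb''
    exact hU b hb''

/-! ## §3 (FL) from the regional existence clause of Theorem 1 -/

variable (F 𝔠 γ hγ hγ1 K) in
/-- **★★ (FL) ⇐ THEOREM 1 (8) ON THE REGION, ONE LEVEL DOWN, + (11)** (`1 ≤ B`, the windows `θ(K−k) ≥ 0`).  HYPOTHESIS `hLift` (the LOCATED SHAPE of the missing regional row —
[Balaban1985Variational] Thm 1 p.279, existence clause with the fine-regularity half of (2), read on `Ω_{k+1}(h)` with free seam; never asserted): for `k + 1 ≤ K`, every admissible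
non-trivial `h` at level `k + 1` and every level-`k` field `V` whose plaquettes in `plaqsIn k Ω_{k+1}(h)` are within `ε_W(k+1) = 2L²·avgWindowFactor·θ(K−k)` of `1`, some finest field has
exact `k`-fold `blockAvg ℰp`-averages `V` on `bondsIn k Ω_{k+1}(h)` and finest plaquettes under `Ω_{k+1}(h)` `< B·ε_W(k+1)·L^{−2k}`.  CONCLUSION: `InnerFineLiftsT3 F 𝔠 γ hγ hγ1 K (B·L²)` —
at level `k + 1` apply `hLift` to `V := faceSec W` (§1: windowed with the same constant; §2: exactness composes), `B·ε·L^{−2k} = (B·L²)·ε·L^{−2(k+1)}` ((13), `C₁ = L²`); at level `0` take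
`U := W`. [cite: Balaban1985Variational, Thm 1 (8) p.279, (11)–(14) pp.279–280; Balaban1985UV3, (40)+(42) p.266] -/
theorem AlphaInputsT3AC.innerFineLiftsT3_of_regionalLifts {B : ℝ} (hB : 1 ≤ B)
    (hθ : ∀ k : ℕ, k + 1 ≤ K → 0 ≤ θBal F.L γ 𝔠.b₀ 𝔠.p₀ (K - k))
    (hLift : ∀ (k : ℕ), k + 1 ≤ K → ∀ (h : Hist (F.P K) (k + 1)),
      Hist.Admissible 𝔠.lane.carrier.M₁ (rcolOf (T3Scales F γ hγ (hγ1.trans (sq_min_one_le _ 𝔠.gamma0_pos)) K) 𝔠.lane.carrier) (k + 1) h →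
      h ≠ Hist.triv (F.P K) (k + 1) → ∀ (V : GaugeField (F.P K) k (Matrix.specialUnitaryGroup (Fin 2) ℂ)),
        (∀ Q : Plaq (F.P K) k, Q ∈ plaqsIn k (Omega 𝔠.lane.carrier.M₁
            (rcolOf (T3Scales F γ hγ (hγ1.trans (sq_min_one_le _ 𝔠.gamma0_pos)) K) 𝔠.lane.carrier) (k + 1) h (k + 1)) →
          GaugeGroup.dist1 (GaugeField.plaqHol V Q) ≤ 2 * (F.L : ℝ) ^ 2 * avgWindowFactor F.L * θBal F.L γ 𝔠.b₀ 𝔠.p₀ (K - k)) →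
        ∃ U : GaugeField (F.P K) 0 (Matrix.specialUnitaryGroup (Fin 2) ℂ),
          (∀ b : PBond (F.P K) k, b ∈ bondsIn k (Omega 𝔠.lane.carrier.M₁
              (rcolOf (T3Scales F γ hγ (hγ1.trans (sq_min_one_le _ 𝔠.gamma0_pos)) K) 𝔠.lane.carrier) (k + 1) h (k + 1)) →
            Averaging.iter (fun i => BlockAveraging.blockAvg (P := F.P K) (j := i) ℰp) k U b = V b) ∧
          ∀ q : Plaq (F.P K) 0, q ∈ plaqsIn 0 (Omega 𝔠.lane.carrier.M₁
              (rcolOf (T3Scales F γ hγ (hγ1.trans (sq_min_one_le _ 𝔠.gamma0_pos)) K) 𝔠.lane.carrier) (k + 1) h (k + 1)) →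
            GaugeGroup.dist1 (GaugeField.plaqHol U q) <
              B * (2 * (F.L : ℝ) ^ 2 * avgWindowFactor F.L * θBal F.L γ 𝔠.b₀ 𝔠.p₀ (K - k)) * (((F.L : ℝ) ^ k)⁻¹) ^ 2) :
    AlphaInputsT3AC.InnerFineLiftsT3 F 𝔠 γ hγ hγ1 K (B * (F.L : ℝ) ^ 2) := by
  have hL : (0 : ℝ) < F.L := by exact_mod_cast (zero_lt_one.trans F.hL.2)
  have hL1 : (1 : ℝ) ≤ (F.L : ℝ) ^ 2 := one_le_pow₀ (by exact_mod_cast F.hL.2.le)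
  have hBL : 1 ≤ B * (F.L : ℝ) ^ 2 := one_le_mul_of_one_le_of_one_le hB hL1
  intro k' hk' h hadm hnt W hW
  rcases k' with _ | k
  · -- level `0`: the datum itself
    refine ⟨W, fun b _ => rfl, fun q hq => ?_⟩
    have hlt := hW.2 q hq
    have hpos : 0 < 2 * (F.L : ℝ) ^ 2 * avgWindowFactor F.L * θBal F.L γ 𝔠.b₀ 𝔠.p₀ (K - 0 + 1) :=
      lt_of_le_of_lt (GaugeGroup.dist1_nonneg _) hlt
    rw [pow_zero, inv_one, one_pow, mul_one]
    exact hlt.trans_le (le_mul_of_one_le_left hpos.le hBL)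
  · -- level `k + 1`: the section `faceSec W`, then the regional lift one level down
    have e : K - (k + 1) + 1 = K - k := by omega
    rw [e]
    set ε : ℝ := 2 * (F.L : ℝ) ^ 2 * avgWindowFactor F.L * θBal F.L γ 𝔠.b₀ 𝔠.p₀ (K - k) with hε
    have hεnn : 0 ≤ ε := by
      have hA : 0 ≤ avgWindowFactor F.L := by unfold avgWindowFactor; positivity
      have := hθ k hk'
      positivity
    have hWle : ∀ Q : Plaq (F.P K) (k + 1), Q ∈ plaqsIn (k + 1) (Omega 𝔠.lane.carrier.M₁
        (rcolOf (T3Scales F γ hγ (hγ1.trans (sq_min_one_le _ 𝔠.gamma0_pos)) K) 𝔠.lane.carrier) (k + 1) h (k + 1)) →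
        GaugeGroup.dist1 (GaugeField.plaqHol W Q) ≤ ε := fun Q hQ => by
      have := hW.2 Q hQ
      rw [e] at this
      exact this.le
    have hV := AlphaInputsT3AC.faceSec_window_region (hγ := hγ) (hγ1 := hγ1) hk' h W hεnn hWle
    obtain ⟨U, hUavg, hUreg⟩ := hLift k hk' h hadm hnt (faceSec W) hV
    refine ⟨U, AlphaInputsT3AC.mem_top42Set_of_iter_eq_faceSec (hγ := hγ) (hγ1 := hγ1) hk' h W hUavg, fun q hq => ?_⟩
    have hlt := hUreg q hq
    have hLk : (0 : ℝ) < (F.L : ℝ) ^ k := pow_pos hL k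
    calc GaugeGroup.dist1 (GaugeField.plaqHol U q) < B * ε * (((F.L : ℝ) ^ k)⁻¹) ^ 2 := hlt
      _ = B * (F.L : ℝ) ^ 2 * ε * (((F.L : ℝ) ^ (k + 1))⁻¹) ^ 2 := by
          field_simp
          ring

end T3

end Summit.QuantumFields.YangMills.Theorems

end
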